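import Summits.QuantumFields.BalabanUV.Beta.GAN24.SymCorrectorExitFace
import Summits.QuantumFields.BalabanUV.Beta.GAN24.CurrentSymSectorSplit
import Summits.QuantumFields.BalabanUV.Beta.GAN24.CurrentSymTowerComb

/-!
# `BalabanUV.Beta.GAN24.SymCorrectorClassCurrent` — binder row G-an2-4 ∕ (CONV-C), TRANSFER-III (the (α-0) chain at row D1's literal of record (III′)), the (C)-row at the
# comb data, STRUCTURAL LETTER (ii) of the OWNER gan24-p1 g50's sizing memo `C-ROW-AT-COMB-SIZING-g50.md` §2 («class-current symmetry survives `slotPsiS` — plausible, the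
# face sum is a class-weighted current; TO BE TYPED»): **CLASS-CURRENT SYMMETRY SURVIVES THE TABLE TRANSPORT `𝒯 S := κ u ↦ Ψ̂_Sᵀ ∘ slotPsiS S κ u ∘ Ψ̂_S`** — the exit-face
# class weights `c + dΨ` of the current-symmetry towers DO NOT SEE the slot transport nor the left leg corrector (a face-crossing slot bond carries no face weight), and the
# right corrector transports the free leg into a finite combination of free legs; hence the `𝒯`-transported comb-chart slot tables `SpureCombOf ∕ ScombOf (symTablesAn1S2 d Lc cΛt)`
# are class-current symmetric at every level with NO displayed hypothesis.

NOT IN PRINT; OUR BOOKKEEPING (G-an2-4 crux team (2), leaf prover `b2b-balaban-gan24-formalise-leaf-01`, gen 84; [folklore] bookkeeping BY NAME over d1-formalise-leaf-03's TT3a∕TT3b∕TT5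
`SymCorrectorFace.faceWt_eq_zero_of_blk_ne ∕ slotPsiS`, `SymCorrectorSlot.comp_trK_psiKS_inl_left ∕ comp_psiKS_inl_right ∕ _inr_right`, `SymCorrectorSockets.locStencil_slotPsiS`, MY
`SymCorrectorZeroMode.tsum_slotPsiS_param` ∕ `SymCorrectorExitFace.slotPsiS_eq_of_exitFace`, leaf-04's current-symmetry kit `ExitFaceCurrentSectorSplit.summable_slot_locStencil` ∕ `CurrentSymSectorSplit.summable_leg_slot_fst ∕
abs_classDatum_le` and leaf-04 g77's `CurrentSymTowerComb.sym_SpureCombOf_an1S2 ∕ sym_ScombOf_an1S2`; generic `d`, `0 < n`, `r ∈ box (d+1) n`; 0 `def`, 0 cited facts, 0 `def … : Prop`,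
0 sorry).  HONEST FRAMING (cell contract, verbatim): «discharging `BetaPertH` makes Bałaban's UV stability UNCONDITIONAL — a real constructive-QFT result; it is NOT the continuum
limit and NOT the Clay problem.»  HONEST DEPENDENCY (verbatim): «continuum YM on T⁴ ⇐ BetaPertH ∧ nine spine estimates (0/9 proved); BetaPertH ⇐ (D1) ∧ (D4) ∧ CAP+tail; G-an2-4
gates asym, D1 and NE2/3/4.»

WHY.  The memo's (C)-campaign at (III′) (§2 row `hB0`): the CANCELLATION half of the forcing's cell charge (leaf-04's 33_j) rests on the class-current symmetry of the running slot
tables; at (III′) the forcing words read `𝒯`-transported tables (road-P2 g55's `CombCubicStepTransport`: `e3OfK n (Ψ̂∘K∘Ψ̂ᵀ) S = e3OfK n K (𝒯 S)`), so the symmetry must survive `𝒯`.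
It does — this is the second of the memo's two OPEN structural letters (the first, zero-mode neutrality of `𝒯₄`, is MY `SymCorrectorZeroMode`).

WHAT (the class-weighted two-leg current of a slot family `S` at the free leg `(p, a)`, weights read at one coordinate: `P_S[s, h](p, a) := Σ'_q h(q_β) Σ'_u s(u_ν) S ν u q p (inl β) a
+ Σ'_q s(q_ν) Σ'_u h(u_β) S β u q p (inl ν) a` — written inline, no definition; «exit-face supported» = `w m = 0` unless `m % n = n − 1`):
* §1 = MY `SymCorrectorExitFace` §1 BY NAME (`slotPsiS_eq_of_exitFace`: `u_ν % n = n − 1 ⟹ slotPsiS r n T ν u = T ν u`; `mul_slotPsiS_eq_of_faceSupported`).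
* §2 **`classCurrent_slotPsiS_eq`** ((a) `P_{slotPsiS S} = P_S`, any family, both weights exit-face supported — summand by summand); **`classCurrent_comp_trK_psiKS_eq`** ((b) `P_{Ψ̂ᵀ∘S} = P_S`);
  `classCurrent_comp_psiKS_inr_eq` ((c) multiplier free leg untouched); `mul_slotPsiS`, `slotPsiS_add_apply`; **`classCurrent_comp_psiKS_inl_eq`** ((c) field free leg: `P_{S∘Ψ̂}(p, inl α) =
  slotPsiS r n (κ v ↦ P_S(v, inl κ)) α p`, local stencil `S`, bounded weights).
* §3 `exists_locStencil_comp_trK_psiKS_slotPsiS`; **`classCurrentSym_transport`**: `(∀ p a, P_S[s,h](p,a) = 0) ⟹ ∀ p a, P_{𝒯 S}[s,h](p,a) = 0`.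
* §4 (comb data, `Ψ̂_S = psiKS (ctrOff (d+1) Lc) Lc`) **`sym_transport_SpureCombOf_an1S2`**, **`sym_transport_ScombOf_an1S2`**: the ∀-statement of `CurrentSymTowerComb.sym_SpureCombOf_an1S2 ∕
  sym_ScombOf_an1S2` VERBATIM with the table replaced by its `𝒯`-transport — every `j ν β`, all class data, every free leg, NO displayed hypothesis.
WHAT THIS IS NOT.  A letter about OUR typed corrector and leaf-04's typed symmetry; asserts NO value of Bałaban's tables; does NOT type the (III′) twin of 33_j ∕ `hB0` (the forcing's cell
pair form at the comb data), NOT (d′)∕(d″) (engine question E0); the (III′) campaign is NOT asked (an2 W-4) — zero weight; NEVER «G-an2-4 closed» as (CONV-C); NOT D1, NOT `BetaPertH`,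
NOT continuum, NOT Clay; not in print.  `bears_on: R4-G`.  2026-08-27.
-/

noncomputable section

open Finset
open scoped BigOperators
open Literature.MathematicalPhysics.QuantumFieldTheory
open Literature.MathematicalPhysics.QuantumFieldTheory.Balaban1983to89
open Literature.MathematicalPhysics.QuantumFieldTheory.Balaban1983to89.Beta
open B12Sec2to5 (l1 l1_nonneg)
open ExpKernelCalculus (MKer BiLoc Decays comp biLoc_comp_decays Zl Zl_nonneg)
open OneStepResolventKernel (Fib LocStencil)
open AffineAveraging (Site Form1 box toSite unitVec unitVec_apply)
open AveragingContours (blk)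
open AveragingContoursRooted (ctrOff ctrOff_mem_box)
open Summit.QuantumFields.BalabanUV.Beta.TameKernelCalculus (trK decays_trK)
open Summit.QuantumFields.BalabanUV.Beta.KernelWardRelative (gaugeWt)
open Summit.QuantumFields.BalabanUV.Beta.SymmetrisedStepJets (SymTables)
open Summit.QuantumFields.BalabanUV.Beta.CombChartStepJets (ScombOf SpureCombOf locStencil_ScombOf locStencil_SpureCombOf)
open Summit.QuantumFields.BalabanUV.Beta.SymSecondOrderTablesAn1 (symTablesAn1S2)
open Summit.QuantumFields.BalabanUV.Beta.GAN24.CurrentSymTowerComb (sym_ScombOf_an1S2 sym_SpureCombOf_an1S2)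
open Summit.QuantumFields.BalabanUV.Beta.CompositeCorrectorKernel (kerBound)
open Summit.QuantumFields.BalabanUV.Beta.SymCorrectorKernel (psiKS decays_psiKS)
open Summit.QuantumFields.BalabanUV.Beta.SymCorrectorFace (faceWt faceWt_eq_zero_of_blk_ne bondNbhd faceSum slotPsiS slotPsiS_apply slotPsiS_zero slotPsiS_apply_kernel)
open Summit.QuantumFields.BalabanUV.Beta.SymCorrectorSockets (locStencil_slotPsiS)
open Summit.QuantumFields.BalabanUV.Beta.SymCorrectorSlot (comp_trK_psiKS_inl_left comp_psiKS_inl_right comp_psiKS_inr_right)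
open Summit.QuantumFields.BalabanUV.Beta.GAN24.ExitFaceCurrentSectorSplit (summable_slot_locStencil)
open Summit.QuantumFields.BalabanUV.Beta.GAN24.CurrentSymSectorSplit (summable_leg_slot_fst abs_classDatum_le)
open Summit.QuantumFields.BalabanUV.Beta.GAN24.SymCorrectorZeroMode (tsum_slotPsiS_param)
open Summit.QuantumFields.BalabanUV.Beta.GAN24.SymCorrectorExitFace (slotPsiS_eq_of_exitFace mul_slotPsiS_eq_of_faceSupported)

namespace Summit.QuantumFields.BalabanUV.Beta.GAN24.SymCorrectorClassCurrent

variable {d : ℕ} {n : ℕ} (hn : 0 < n)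
include hn

/-! ## §1 Exit-face weights are blind to the slot transport — MY `SymCorrectorExitFace` §1 (`slotPsiS_eq_of_exitFace`, `mul_slotPsiS_eq_of_faceSupported`), opened by name -/

variable {r : Fin (d + 1) → ℕ} (hr : r ∈ box (d + 1) n)
include hr

/-! ## §2 The class-weighted two-leg current under the three transports -/

section Current

variable (S : Fin (d + 1) → Site (d + 1) → MKer (d + 1) (Fib d)) {h s : ℤ → ℝ}
  (hh : ∀ m : ℤ, m % (n : ℤ) ≠ (n : ℤ) - 1 → h m = 0) (hs : ∀ m : ℤ, m % (n : ℤ) ≠ (n : ℤ) - 1 → s m = 0)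
include hh hs

/-- [folklore] **(a) THE SLOT TRANSPORT IS INVISIBLE TO THE CLASS-WEIGHTED CURRENT** (both class data exit-face supported; ANY family, no summability, no symmetry needed):
`P_{slotPsiS r n S}[s, h](p, a) = P_S[s, h](p, a)` — summand by summand. -/
theorem classCurrent_slotPsiS_eq (ν β : Fin (d + 1)) (p : Site (d + 1)) (a : Fib d) :
    (∑' q : Site (d + 1), h (q β) * ∑' u : Site (d + 1), s (u ν) * slotPsiS r n S ν u q p (Sum.inl β) a) +
        ∑' q : Site (d + 1), s (q ν) * ∑' u : Site (d + 1), h (u β) * slotPsiS r n S β u q p (Sum.inl ν) a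
      = (∑' q : Site (d + 1), h (q β) * ∑' u : Site (d + 1), s (u ν) * S ν u q p (Sum.inl β) a) +
        ∑' q : Site (d + 1), s (q ν) * ∑' u : Site (d + 1), h (u β) * S β u q p (Sum.inl ν) a := by
  have e1 : ∀ q u, s (u ν) * slotPsiS r n S ν u q p (Sum.inl β) a = s (u ν) * S ν u q p (Sum.inl β) a := fun q u => by
    rw [slotPsiS_apply_kernel, mul_slotPsiS_eq_of_faceSupported hn hr hs]
  have e2 : ∀ q u, h (u β) * slotPsiS r n S β u q p (Sum.inl ν) a = h (u β) * S β u q p (Sum.inl ν) a := fun q u => by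
    rw [slotPsiS_apply_kernel, mul_slotPsiS_eq_of_faceSupported hn hr hh]
  simp only [e1, e2]

/-- [folklore] **(b) THE LEFT LEG CORRECTOR `Ψ̂ᵀ ∘ ·` IS INVISIBLE TO THE CLASS-WEIGHTED CURRENT** (the weighted leg `(q, inl β)` of `Ψ̂ᵀ ∘ X` is the slot transport of `X`'s left-leg family,
TT3b `comp_trK_psiKS_inl_left`; its weight is exit-face supported): `P_{Ψ̂ᵀ ∘ S}[s, h](p, a) = P_S[s, h](p, a)`, summand by summand. -/
theorem classCurrent_comp_trK_psiKS_eq (ν β : Fin (d + 1)) (p : Site (d + 1)) (a : Fib d) :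
    (∑' q : Site (d + 1), h (q β) * ∑' u : Site (d + 1), s (u ν) * comp (trK (psiKS r n)) (S ν u) q p (Sum.inl β) a) +
        ∑' q : Site (d + 1), s (q ν) * ∑' u : Site (d + 1), h (u β) * comp (trK (psiKS r n)) (S β u) q p (Sum.inl ν) a
      = (∑' q : Site (d + 1), h (q β) * ∑' u : Site (d + 1), s (u ν) * S ν u q p (Sum.inl β) a) +
        ∑' q : Site (d + 1), s (q ν) * ∑' u : Site (d + 1), h (u β) * S β u q p (Sum.inl ν) a := by
  have e1 : ∀ q, h (q β) * (∑' u : Site (d + 1), s (u ν) * comp (trK (psiKS r n)) (S ν u) q p (Sum.inl β) a)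
      = h (q β) * ∑' u : Site (d + 1), s (u ν) * S ν u q p (Sum.inl β) a := fun q => by
    rw [← tsum_mul_left, ← tsum_mul_left]
    refine tsum_congr fun u => ?_
    rw [mul_left_comm, comp_trK_psiKS_inl_left hn hr, mul_slotPsiS_eq_of_faceSupported hn hr hh, mul_left_comm]
  have e2 : ∀ q, s (q ν) * (∑' u : Site (d + 1), h (u β) * comp (trK (psiKS r n)) (S β u) q p (Sum.inl ν) a)
      = s (q ν) * ∑' u : Site (d + 1), h (u β) * S β u q p (Sum.inl ν) a := fun q => by
    rw [← tsum_mul_left, ← tsum_mul_left]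
    refine tsum_congr fun u => ?_
    rw [mul_left_comm, comp_trK_psiKS_inl_left hn hr, mul_slotPsiS_eq_of_faceSupported hn hr hs, mul_left_comm]
  rw [tsum_congr e1, tsum_congr e2]

omit hn hr hh hs in
/-- [folklore] **(c, multiplier free leg) THE RIGHT LEG CORRECTOR `· ∘ Ψ̂` IS INVISIBLE AT A MULTIPLIER FREE LEG**: `P_{S ∘ Ψ̂}[s, h](p, inr m) = P_S[s, h](p, inr m)`. -/
theorem classCurrent_comp_psiKS_inr_eq (h s : ℤ → ℝ) (ν β : Fin (d + 1)) (p : Site (d + 1)) (m : Fin (d + 1)) :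
    (∑' q : Site (d + 1), h (q β) * ∑' u : Site (d + 1), s (u ν) * comp (S ν u) (psiKS r n) q p (Sum.inl β) (Sum.inr m)) +
        ∑' q : Site (d + 1), s (q ν) * ∑' u : Site (d + 1), h (u β) * comp (S β u) (psiKS r n) q p (Sum.inl ν) (Sum.inr m)
      = (∑' q : Site (d + 1), h (q β) * ∑' u : Site (d + 1), s (u ν) * S ν u q p (Sum.inl β) (Sum.inr m)) +
        ∑' q : Site (d + 1), s (q ν) * ∑' u : Site (d + 1), h (u β) * S β u q p (Sum.inl ν) (Sum.inr m) := by
  simp only [comp_psiKS_inr_right]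

omit hn hr hh hs in
/-- [folklore] A scalar multiple moves inside the slot transport: `c · slotPsiS r n F α x = slotPsiS r n (c • F) α x`. -/
theorem mul_slotPsiS (c : ℝ) (F : Form1 (d + 1) ℝ) (α : Fin (d + 1)) (x : Site (d + 1)) :
    c * slotPsiS r n F α x = slotPsiS r n (fun κ u => c * F κ u) α x := by
  rw [slotPsiS_apply, slotPsiS_apply]
  simp only [smul_eq_mul, mul_add, Finset.mul_sum]
  congr 1
  exact Finset.sum_congr rfl fun κ _ => Finset.sum_congr rfl fun u _ => by ring

omit hn hr hh hs in
/-- [folklore] The slot transport is additive in the family (pointwise form). -/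
theorem slotPsiS_add_apply (F G : Form1 (d + 1) ℝ) (α : Fin (d + 1)) (x : Site (d + 1)) :
    slotPsiS r n F α x + slotPsiS r n G α x = slotPsiS r n (fun κ u => F κ u + G κ u) α x := by
  rw [slotPsiS_apply, slotPsiS_apply, slotPsiS_apply]
  simp only [smul_eq_mul, mul_add, Finset.sum_add_distrib]
  ring

omit hh hs in
/-- [folklore] **(c, field free leg) THE RIGHT LEG CORRECTOR TRANSPORTS THE FREE LEG OF THE CURRENT**: for a local stencil family `S` (rate `> 0`) and bounded weights,
`P_{S ∘ Ψ̂}[s, h](p, inl α) = slotPsiS r n (κ v ↦ P_S[s, h](v, inl κ)) α p` — the right field leg of `S ν u ∘ Ψ̂` is the slot transport of `S ν u`'s right-leg family (TT3b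
`comp_psiKS_inl_right`), and the two series commute with the transport (`SymCorrectorZeroMode.tsum_slotPsiS_param`). -/
theorem classCurrent_comp_psiKS_inl_eq {Cs δs : ℝ} (hS : LocStencil S Cs δs) (hδs : 0 < δs) {h s : ℤ → ℝ} {Bh Bs : ℝ} (hhB : ∀ m, |h m| ≤ Bh)
    (hsB : ∀ m, |s m| ≤ Bs) (ν β : Fin (d + 1)) (p : Site (d + 1)) (α : Fin (d + 1)) :
    (∑' q : Site (d + 1), h (q β) * ∑' u : Site (d + 1), s (u ν) * comp (S ν u) (psiKS r n) q p (Sum.inl β) (Sum.inl α)) +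
        ∑' q : Site (d + 1), s (q ν) * ∑' u : Site (d + 1), h (u β) * comp (S β u) (psiKS r n) q p (Sum.inl ν) (Sum.inl α)
      = slotPsiS r n (fun κ v =>
          (∑' q : Site (d + 1), h (q β) * ∑' u : Site (d + 1), s (u ν) * S ν u q v (Sum.inl β) (Sum.inl κ)) +
            ∑' q : Site (d + 1), s (q ν) * ∑' u : Site (d + 1), h (u β) * S β u q v (Sum.inl ν) (Sum.inl κ)) α p := by
  -- one summand at a time: the weighted series of slot transports is the slot transport of the weighted series
  have one : ∀ (ν β : Fin (d + 1)) (h s : ℤ → ℝ) (Bh Bs : ℝ), (∀ m, |h m| ≤ Bh) → (∀ m, |s m| ≤ Bs) →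
      (∑' q : Site (d + 1), h (q β) * ∑' u : Site (d + 1), s (u ν) * comp (S ν u) (psiKS r n) q p (Sum.inl β) (Sum.inl α))
        = slotPsiS r n (fun κ v => ∑' q : Site (d + 1), h (q β) * ∑' u : Site (d + 1), s (u ν) * S ν u q v (Sum.inl β) (Sum.inl κ)) α p := by
    intro ν β h s Bh Bs hhB hsB
    have hu : ∀ q, (∑' u : Site (d + 1), s (u ν) * comp (S ν u) (psiKS r n) q p (Sum.inl β) (Sum.inl α))
        = slotPsiS r n (fun κ v => ∑' u : Site (d + 1), s (u ν) * S ν u q v (Sum.inl β) (Sum.inl κ)) α p := by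
      intro q
      have e : ∀ u, s (u ν) * comp (S ν u) (psiKS r n) q p (Sum.inl β) (Sum.inl α)
          = slotPsiS r n (fun κ v => s (u ν) * S ν u q v (Sum.inl β) (Sum.inl κ)) α p := fun u => by
        rw [comp_psiKS_inl_right hn hr, mul_slotPsiS]
      rw [tsum_congr e]
      exact tsum_slotPsiS_param r (F := fun u κ v => s (u ν) * S ν u q v (Sum.inl β) (Sum.inl κ))
        (fun κ v => summable_slot_locStencil hS hδs (s := fun u => s (u ν)) (fun u => hsB _) ν q v _ _) α p
    have e : ∀ q, h (q β) * (∑' u : Site (d + 1), s (u ν) * comp (S ν u) (psiKS r n) q p (Sum.inl β) (Sum.inl α))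
        = slotPsiS r n (fun κ v => h (q β) * ∑' u : Site (d + 1), s (u ν) * S ν u q v (Sum.inl β) (Sum.inl κ)) α p := fun q => by
      rw [hu q, mul_slotPsiS]
    rw [tsum_congr e]
    exact tsum_slotPsiS_param r (F := fun q κ v => h (q β) * ∑' u : Site (d + 1), s (u ν) * S ν u q v (Sum.inl β) (Sum.inl κ))
      (fun κ v => summable_leg_slot_fst hS hδs (h := fun q => h (q β)) (s := fun u => s (u ν)) (fun q => hhB _) (fun u => hsB _) ν v _ _) α p
  rw [one ν β h s Bh Bs hhB hsB, one β ν s h Bs Bh hsB hhB, slotPsiS_add_apply]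

end Current

/-! ## §3 Class-current symmetry survives the table transport `𝒯 S := κ u ↦ Ψ̂ᵀ ∘ slotPsiS r n S κ u ∘ Ψ̂` -/

section Transport

variable {S : Fin (d + 1) → Site (d + 1) → MKer (d + 1) (Fib d)} {Cs δs : ℝ}

/-- [folklore] `κ u ↦ Ψ̂ᵀ ∘ slotPsiS r n S κ u` is a local stencil family (TT5 `locStencil_slotPsiS`, then lit `biLoc_comp_decays` with `Ψ̂ᵀ`; rate `δ/2`). -/
theorem exists_locStencil_comp_trK_psiKS_slotPsiS (hS : LocStencil S Cs δs) (hδs : 0 < δs) :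
    ∃ C : ℝ, LocStencil (fun κ u => comp (trK (psiKS r n)) (slotPsiS r n S κ u)) C (δs / 2) :=
  ⟨_, fun κ u => biLoc_comp_decays (decays_trK (decays_psiKS hn hr hδs.le)) (locStencil_slotPsiS hn r hS hδs.le κ u)
    (show (0 : ℝ) ≤ δs / 2 by positivity) (by linarith)⟩

/-- **CLASS-CURRENT SYMMETRY SURVIVES THE TABLE TRANSPORT `𝒯`** [our bookkeeping; folklore composition] — STRUCTURAL LETTER (ii) of the OWNER gan24-p1 g50's memo
`C-ROW-AT-COMB-SIZING-g50.md` §2 («class-current symmetry survives `slotPsiS` — plausible; TO BE TYPED»): for a local stencil family `S` (rate `> 0`), bounded EXIT-FACE-SUPPORTED class weights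
`h`, `s` (`h m = s m = 0` unless `m % n = n − 1` — the `c + dΨ` data of the current-symmetry towers), `0 < n`, `r ∈ box (d+1) n`, `Ψ̂ = psiKS r n`: if the slot↔leg-symmetrised class-weighted
two-leg current of `S` vanishes at every free leg, `∀ p a, Σ'_q h(q_β) Σ'_u s(u_ν) S ν u q p (inl β) a + Σ'_q s(q_ν) Σ'_u h(u_β) S β u q p (inl ν) a = 0`, then so does that of
`𝒯 S := κ u ↦ Ψ̂ᵀ ∘ slotPsiS r n S κ u ∘ Ψ̂` (road-P2 g55's transport of `CombCubicStepTransport`).  Mechanism: the exit-face weights do not see the slot transport (§1) nor the left leg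
corrector (§2 (b)); the right corrector transports the free leg into a finite combination of free legs (§2 (c)). -/
theorem classCurrentSym_transport (hS : LocStencil S Cs δs) (hδs : 0 < δs) {h s : ℤ → ℝ} {Bh Bs : ℝ} (hhB : ∀ m, |h m| ≤ Bh) (hsB : ∀ m, |s m| ≤ Bs)
    (hh : ∀ m : ℤ, m % (n : ℤ) ≠ (n : ℤ) - 1 → h m = 0) (hs : ∀ m : ℤ, m % (n : ℤ) ≠ (n : ℤ) - 1 → s m = 0) (ν β : Fin (d + 1))
    (hsym : ∀ (p : Site (d + 1)) (a : Fib d),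
      (∑' q : Site (d + 1), h (q β) * ∑' u : Site (d + 1), s (u ν) * S ν u q p (Sum.inl β) a) +
        ∑' q : Site (d + 1), s (q ν) * ∑' u : Site (d + 1), h (u β) * S β u q p (Sum.inl ν) a = 0)
    (p : Site (d + 1)) (a : Fib d) :
    (∑' q : Site (d + 1), h (q β) * ∑' u : Site (d + 1), s (u ν) * comp (comp (trK (psiKS r n)) (slotPsiS r n S ν u)) (psiKS r n) q p (Sum.inl β) a) +
        ∑' q : Site (d + 1), s (q ν) * ∑' u : Site (d + 1), h (u β) * comp (comp (trK (psiKS r n)) (slotPsiS r n S β u)) (psiKS r n) q p (Sum.inl ν) a = 0 := by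
  obtain ⟨C', hS'⟩ := exists_locStencil_comp_trK_psiKS_slotPsiS hn hr hS hδs
  -- the inner family `Ψ̂ᵀ ∘ slotPsiS r n S` has the symmetry at every free leg
  have hP' : ∀ (v : Site (d + 1)) (c : Fib d),
      (∑' q : Site (d + 1), h (q β) * ∑' u : Site (d + 1), s (u ν) * comp (trK (psiKS r n)) (slotPsiS r n S ν u) q v (Sum.inl β) c) +
        ∑' q : Site (d + 1), s (q ν) * ∑' u : Site (d + 1), h (u β) * comp (trK (psiKS r n)) (slotPsiS r n S β u) q v (Sum.inl ν) c = 0 := fun v c =>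
    (classCurrent_comp_trK_psiKS_eq hn hr (slotPsiS r n S) hh hs ν β v c).trans ((classCurrent_slotPsiS_eq hn hr S hh hs ν β v c).trans (hsym v c))
  rcases a with α | m
  · calc _ = slotPsiS r n (fun κ v =>
          (∑' q : Site (d + 1), h (q β) * ∑' u : Site (d + 1), s (u ν) * comp (trK (psiKS r n)) (slotPsiS r n S ν u) q v (Sum.inl β) (Sum.inl κ)) +
            ∑' q : Site (d + 1), s (q ν) * ∑' u : Site (d + 1), h (u β) * comp (trK (psiKS r n)) (slotPsiS r n S β u) q v (Sum.inl ν) (Sum.inl κ)) α p :=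
          classCurrent_comp_psiKS_inl_eq hn hr (fun ν u => comp (trK (psiKS r n)) (slotPsiS r n S ν u)) hS' (half_pos hδs) hhB hsB ν β p α
      _ = slotPsiS r n (0 : Form1 (d + 1) ℝ) α p := by
          congr 1; funext κ v; exact hP' v (Sum.inl κ)
      _ = 0 := by rw [slotPsiS_zero]; rfl
  · exact (classCurrent_comp_psiKS_inr_eq (fun ν u => comp (trK (psiKS r n)) (slotPsiS r n S ν u)) h s ν β p m).trans (hP' p (Sum.inr m))

end Transport

end Summit.QuantumFields.BalabanUV.Beta.GAN24.SymCorrectorClassCurrent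

/-! ## §4 At the comb data: the transported comb-chart slot tables keep their current symmetry (any sym record as hypothesis; an1's record hypothesis-free) -/

namespace Summit.QuantumFields.BalabanUV.Beta.GAN24.SymCorrectorClassCurrent

variable {d : ℕ} {Lc : ℕ} [NeZero Lc]

/-- **THE `𝒯`-TRANSPORTED PURE TABLES OF an1's RECORD ARE CLASS-CURRENT SYMMETRIC — NO DISPLAYED HYPOTHESIS** [our bookkeeping; folklore composition]: for every level `j`, all `ν β`,
all exit-face-supported class data `c₁ + dΨ₁`, `c₂ + dΨ₂` (bounded `Ψ`), every free leg `(p, a)`, with `Ψ̂_S = psiKS (ctrOff (d+1) Lc) Lc` and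
`𝒯 S := κ u ↦ Ψ̂_Sᵀ ∘ slotPsiS (ctrOff (d+1) Lc) Lc S κ u ∘ Ψ̂_S`: `P_{𝒯 (SpureCombOf (symTablesAn1S2 d Lc cΛt) cE cVH cΛ j)}[c₂+dΨ₂, c₁+dΨ₁](p, a) = 0`
(leaf-04 g77's `CurrentSymTowerComb.sym_SpureCombOf_an1S2` ⨾ §3). -/
theorem sym_transport_SpureCombOf_an1S2 (cΛt cE cVH cΛ : ℝ) :
    ∀ (j : ℕ) (ν β : Fin (d + 1)) (c₁ : ℝ) (Ψ₁ : ℤ → ℝ) (B₁ : ℝ), (∀ s, |Ψ₁ s| ≤ B₁) → (∀ n : ℤ, n % (Lc : ℤ) ≠ (Lc : ℤ) - 1 → c₁ + (Ψ₁ (n + 1) - Ψ₁ n) = 0) →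
      ∀ (c₂ : ℝ) (Ψ₂ : ℤ → ℝ) (B₂ : ℝ), (∀ s, |Ψ₂ s| ≤ B₂) → (∀ n : ℤ, n % (Lc : ℤ) ≠ (Lc : ℤ) - 1 → c₂ + (Ψ₂ (n + 1) - Ψ₂ n) = 0) →
      ∀ (p : Site (d + 1)) (a : Fib d),
        (∑' q : Site (d + 1), (c₁ + (Ψ₁ (q β + 1) - Ψ₁ (q β))) * ∑' u : Site (d + 1), (c₂ + (Ψ₂ (u ν + 1) - Ψ₂ (u ν))) *
            comp (comp (trK (psiKS (ctrOff (d + 1) Lc) Lc)) (slotPsiS (ctrOff (d + 1) Lc) Lc (SpureCombOf (symTablesAn1S2 d Lc cΛt) cE cVH cΛ j) ν u))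
              (psiKS (ctrOff (d + 1) Lc) Lc) q p (Sum.inl β) a) +
          ∑' q : Site (d + 1), (c₂ + (Ψ₂ (q ν + 1) - Ψ₂ (q ν))) * ∑' u : Site (d + 1), (c₁ + (Ψ₁ (u β + 1) - Ψ₁ (u β))) *
            comp (comp (trK (psiKS (ctrOff (d + 1) Lc) Lc)) (slotPsiS (ctrOff (d + 1) Lc) Lc (SpureCombOf (symTablesAn1S2 d Lc cΛt) cE cVH cΛ j) β u))
              (psiKS (ctrOff (d + 1) Lc) Lc) q p (Sum.inl ν) a = 0 := by
  have hLc : 0 < Lc := Nat.pos_of_ne_zero (NeZero.ne Lc)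
  intro j ν β c₁ Ψ₁ B₁ hΨ₁ hf₁ c₂ Ψ₂ B₂ hΨ₂ hf₂ p a
  obtain ⟨Cs, δs, hδs, hS⟩ := locStencil_SpureCombOf (symTablesAn1S2 d Lc cΛt) cE cVH cΛ j
  exact classCurrentSym_transport hLc (ctrOff_mem_box hLc) hS hδs (h := fun m => c₁ + (Ψ₁ (m + 1) - Ψ₁ m)) (s := fun m => c₂ + (Ψ₂ (m + 1) - Ψ₂ m))
    (abs_classDatum_le c₁ Ψ₁ hΨ₁) (abs_classDatum_le c₂ Ψ₂ hΨ₂) hf₁ hf₂ ν β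
    (fun p a => sym_SpureCombOf_an1S2 (d := d) (Lc := Lc) cΛt cE cVH cΛ j ν β c₁ Ψ₁ B₁ hΨ₁ hf₁ c₂ Ψ₂ B₂ hΨ₂ hf₂ p a) p a

/-- **… AND THE `𝒯`-TRANSPORTED FULL TABLES `ScombOf (symTablesAn1S2 d Lc cΛt)`** [our bookkeeping; folklore composition] (`CurrentSymTowerComb.sym_ScombOf_an1S2` ⨾ §3). -/
theorem sym_transport_ScombOf_an1S2 (cΛt cE cVH cΛ : ℝ) :
    ∀ (j : ℕ) (ν β : Fin (d + 1)) (c₁ : ℝ) (Ψ₁ : ℤ → ℝ) (B₁ : ℝ), (∀ s, |Ψ₁ s| ≤ B₁) → (∀ n : ℤ, n % (Lc : ℤ) ≠ (Lc : ℤ) - 1 → c₁ + (Ψ₁ (n + 1) - Ψ₁ n) = 0) →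
      ∀ (c₂ : ℝ) (Ψ₂ : ℤ → ℝ) (B₂ : ℝ), (∀ s, |Ψ₂ s| ≤ B₂) → (∀ n : ℤ, n % (Lc : ℤ) ≠ (Lc : ℤ) - 1 → c₂ + (Ψ₂ (n + 1) - Ψ₂ n) = 0) →
      ∀ (p : Site (d + 1)) (a : Fib d),
        (∑' q : Site (d + 1), (c₁ + (Ψ₁ (q β + 1) - Ψ₁ (q β))) * ∑' u : Site (d + 1), (c₂ + (Ψ₂ (u ν + 1) - Ψ₂ (u ν))) *
            comp (comp (trK (psiKS (ctrOff (d + 1) Lc) Lc)) (slotPsiS (ctrOff (d + 1) Lc) Lc (ScombOf (symTablesAn1S2 d Lc cΛt) cE cVH cΛ j) ν u))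
              (psiKS (ctrOff (d + 1) Lc) Lc) q p (Sum.inl β) a) +
          ∑' q : Site (d + 1), (c₂ + (Ψ₂ (q ν + 1) - Ψ₂ (q ν))) * ∑' u : Site (d + 1), (c₁ + (Ψ₁ (u β + 1) - Ψ₁ (u β))) *
            comp (comp (trK (psiKS (ctrOff (d + 1) Lc) Lc)) (slotPsiS (ctrOff (d + 1) Lc) Lc (ScombOf (symTablesAn1S2 d Lc cΛt) cE cVH cΛ j) β u))
              (psiKS (ctrOff (d + 1) Lc) Lc) q p (Sum.inl ν) a = 0 := by
  have hLc : 0 < Lc := Nat.pos_of_ne_zero (NeZero.ne Lc)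
  intro j ν β c₁ Ψ₁ B₁ hΨ₁ hf₁ c₂ Ψ₂ B₂ hΨ₂ hf₂ p a
  obtain ⟨Cs, δs, hδs, hS⟩ := locStencil_ScombOf (symTablesAn1S2 d Lc cΛt) cE cVH cΛ j
  exact classCurrentSym_transport hLc (ctrOff_mem_box hLc) hS hδs (h := fun m => c₁ + (Ψ₁ (m + 1) - Ψ₁ m)) (s := fun m => c₂ + (Ψ₂ (m + 1) - Ψ₂ m))
    (abs_classDatum_le c₁ Ψ₁ hΨ₁) (abs_classDatum_le c₂ Ψ₂ hΨ₂) hf₁ hf₂ ν β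
    (fun p a => sym_ScombOf_an1S2 (d := d) (Lc := Lc) cΛt cE cVH cΛ j ν β c₁ Ψ₁ B₁ hΨ₁ hf₁ c₂ Ψ₂ B₂ hΨ₂ hf₂ p a) p a

end Summit.QuantumFields.BalabanUV.Beta.GAN24.SymCorrectorClassCurrent

end
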